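import Summits.Parity.BatemanHorn.Theorems.SelbergDelangeRigidityLSDRealSegmentTailsFacts
import Summits.Parity.BatemanHorn.Theorems.SelbergDelangeRigidityLSDRealSegmentTailsPeeledAux
import Summits.Parity.BatemanHorn.Theorems.SelbergDelangeRigidityLSDRealSegmentTypeISandwich
import HarnessLib

/-!
# Route `SelbergDelangeRigidity`, crux `LSDRealSegment` (stmt-Parity-9770), line
# `product-anatomy-subcritical`: the peeled tilted block sum from Nair–Tenenbaum (conditional helper of `stub_tails`)

THE APPLICATION OF (NT) ON THE LINE: assuming the named fact
`Literature.NumberTheory.Sieve.NairTenenbaum1998_theorem1` (Nair–Tenenbaum 1998, Thm 1, uniform form), for every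
Bateman–Horn system `f : Fin k → ℤ[X]` (`k ≥ 1`), `1 ≤ y < 2`, `0 < ε ≤ 1/(48 g²)` (`g = deg ∏ fᵢ`) and `P ≥ 1` with
`P^ε ≥ y`, the PEELED tilt has block sums of the right order:
`Σ_{X < n ≤ 2X} ∏ᵢ y^{Ω_{>P}(fᵢ(n))} ≤ C X (log X)^{k(y−1)}` for `X ≥ X₀` (`tails_peeledBlock_of_NT`, registered helper).
Ingredients: a Bateman–Horn system satisfies the hypotheses of (NT) (irreducible; pairwise coprime over `ℚ` —
`isCoprime_map_of_isBatemanHornSystem`, from `exists_mul_add_mul_eq_C_of_not_associated`; no fixed prime divisor);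
the peeled tilt is of class `𝓜_k(y, 1, ε)` (`tails_peeledWeight_isClassM` + `isClassMk_prod`); and the right-hand
side of (NT) is `≪ X (log X)^{−k} · ((log X)^{y})^k` (`exists_prod_one_sub_rootCount_le`,
`tails_rootCountHarmonic_le`).  Restoring the small primes `p ≤ P` (the un-capped `y^{Ω}`) is where (R) enters —
not done here.
-/

open Filter Finset Polynomial
open scoped BigOperators Topology Classical

namespace Summit.Parity.BatemanHorn.Cruxes.LSDRealSegment.ProductAnatomySubcritical

open Literature.NumberTheory.Sieve
open ArithmeticFunction (cardFactors)
noncomputable section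

variable {k : ℕ}

/-- Two members of a Bateman–Horn system are coprime in `ℚ[X]` (`fᵢ a + fⱼ b = c ≠ 0` in `ℤ[X]`). [folklore] -/
theorem isCoprime_map_of_isBatemanHornSystem {f : Fin k → ℤ[X]} (hf : IsBatemanHornSystem f) {i j : Fin k}
    (hij : i ≠ j) : IsCoprime ((f i).map (Int.castRingHom ℚ)) ((f j).map (Int.castRingHom ℚ)) := by
  obtain ⟨a, b, c, hc, h⟩ := exists_mul_add_mul_eq_C_of_not_associated (hf.irreducible i) (hf.irreducible j)
    (hf.pairwise_not_associated hij)
  set φ := Int.castRingHom ℚ with hφ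
  have h' : (f i).map φ * a.map φ + (f j).map φ * b.map φ = Polynomial.C (c : ℚ) := by
    have := congrArg (Polynomial.map φ) h
    simpa [Polynomial.map_add, Polynomial.map_mul] using this
  have hc' : (c : ℚ) ≠ 0 := by exact_mod_cast hc
  refine ⟨a.map φ * Polynomial.C ((c : ℚ)⁻¹), b.map φ * Polynomial.C ((c : ℚ)⁻¹), ?_⟩
  calc a.map φ * Polynomial.C ((c : ℚ)⁻¹) * (f i).map φ + b.map φ * Polynomial.C ((c : ℚ)⁻¹) * (f j).map φ
      = ((f i).map φ * a.map φ + (f j).map φ * b.map φ) * Polynomial.C ((c : ℚ)⁻¹) := by ring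
    _ = Polynomial.C (c : ℚ) * Polynomial.C ((c : ℚ)⁻¹) := by rw [h']
    _ = 1 := by rw [← Polynomial.C_mul, mul_inv_cancel₀ hc', Polynomial.C_1]

/-- The primes of `[1, N]` are `Nat.primesLE N`. [folklore] -/
theorem filter_prime_Icc_eq_primesLE (N : ℕ) : (Icc 1 N).filter Nat.Prime = Nat.primesLE N := by
  ext p
  rw [Finset.mem_filter, Finset.mem_Icc, Nat.mem_primesLE]
  exact ⟨fun h => ⟨h.1.2, h.2⟩, fun h => ⟨⟨h.2.one_lt.le, h.1⟩, h.2⟩⟩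

/-- For `n` with all `fᵢ(n) ≥ 1`: `val f i n = |fᵢ(n)|`. [folklore] -/
theorem val_eq_natAbs {f : Fin k → ℤ[X]} {n : ℕ} (hn : ∀ i, (1 : ℤ) ≤ (f i).eval (n : ℤ)) (i : Fin k) :
    val f i n = ((f i).eval (n : ℤ)).natAbs := by
  have h := hn i
  have e : (((f i).eval (n : ℤ)).toNat : ℤ) = (((f i).eval (n : ℤ)).natAbs : ℤ) := by
    rw [Int.toNat_of_nonneg (by omega), Int.natAbs_of_nonneg (by omega)]
  rw [val, max_eq_left (by omega), show ((f i).eval (n : ℤ)).toNat = ((f i).eval (n : ℤ)).natAbs by exact_mod_cast e]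

/-- **tails_peeledBlock_of_NT** (registered helper of `stub_tails`, line `product-anatomy-subcritical`; CONDITIONAL
on the named fact `NairTenenbaum1998_theorem1`): along a Bateman–Horn system with `k ≥ 1` members, for
`1 ≤ y < 2`, `0 < ε ≤ 1/(48 g²)` and `P ≥ 1` with `y ≤ P^ε`, the peeled tilt has dyadic block sums
`Σ_{X < n ≤ 2X} ∏ᵢ y^{Ω(val f i n / smoothPart P (val f i n))} ≤ C X (log X)^{k(y−1)}` for `X ≥ X₀`. [folklore] -/
theorem tails_peeledBlock_of_NT : NairTenenbaum1998_theorem1 →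
    ∀ (k : ℕ) (f : Fin k → ℤ[X]), IsBatemanHornSystem f → 0 < k → ∀ (y ε P : ℝ), 1 ≤ y → y < 2 → 0 < ε →
      ε ≤ 1 / (48 * (((∏ i, f i).natDegree : ℕ) : ℝ) ^ 2) → 1 ≤ P → y ≤ P ^ ε →
      ∃ C X₀ : ℝ, ∀ X : ℝ, X₀ ≤ X →
        (∑ n ∈ Finset.Ioc ⌊X⌋₊ ⌊2 * X⌋₊, ∏ i, y ^ cardFactors (val f i n / smoothPart P (val f i n))) ≤
          C * (X * Real.log X ^ ((k : ℝ) * (y - 1))) := by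
  intro hNT k f hf hk y ε P hy hy2 hε hεg hP hyP
  have hy0 : 0 ≤ y := by linarith
  -- (NT) for the system with `α = δ = 1/2`, `A = y`, `B = 1`
  have hε' : ε ≤ 1 / 2 * (1 / 2) / (12 * ((((∏ i, f i).natDegree : ℕ)) : ℝ) ^ 2) := by
    convert hεg using 1
    ring
  obtain ⟨c₀, C, hC⟩ := hNT k (∏ i, f i).natDegree ((∏ i, f i).discr) y 1 (1 / 2) (1 / 2) ε
    (by omega) hy le_rfl (by norm_num) (by norm_num) (by norm_num) (by norm_num) hε hε'
  have hcls : IsClassMk k y 1 ε (fun n => ∏ i, y ^ cardFactors (n i / smoothPart P (n i))) := by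
    have h := isClassMk_prod (k := k) hy zero_le_one (F := fun _ m => y ^ cardFactors (m / smoothPart P m))
      (fun _ => tails_peeledWeight_isClassM y ε P hy hε hP hyP)
    simpa only [one_pow] using h
  have hNT' := hC f hf.irreducible (fun i j hij => isCoprime_map_of_isBatemanHornSystem hf hij)
    hf.hasNoFixedPrimeDivisor rfl rfl _ hcls
  -- sizes of the right-hand side, positivity threshold
  obtain ⟨M, hM0, hM⟩ := exists_prod_one_sub_rootCount_le hf
  obtain ⟨K, hK⟩ := tails_rootCountHarmonic_le k f hf y hy hy2
  obtain ⟨n₀, hn₀⟩ := exists_forall_one_le_eval hf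
  set K' : ℝ := max K 0 with hK'
  set H : ℝ := (polyHeight (∏ j, f j) : ℝ) with hH
  set X₀ : ℝ := max (max (c₀ * H ^ (1 / 2 : ℝ)) ((n₀ : ℝ) + 2)) 4 with hX₀
  refine ⟨|C| * (M * 2 ^ k) * K' ^ k, X₀, fun X hX => ?_⟩
  have hX4 : (4 : ℝ) ≤ X := le_trans (le_max_right _ _) hX
  have hXc : c₀ * H ^ (1 / 2 : ℝ) ≤ X := le_trans (le_trans (le_max_left _ _) (le_max_left _ _)) hX
  have hXn : (n₀ : ℝ) + 2 ≤ X := le_trans (le_trans (le_max_right _ _) (le_max_left _ _)) hX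
  have hX1 : (1 : ℝ) < X := by linarith
  have hX0 : (0 : ℝ) ≤ X := by linarith
  have hlogX : 0 < Real.log X := Real.log_pos hX1
  set N : ℕ := ⌊X⌋₊ with hN
  have hN4 : 4 ≤ N := Nat.le_floor (by exact_mod_cast hX4)
  have hNn : n₀ + 2 ≤ N := Nat.le_floor (by push_cast; linarith)
  have hNX : (N : ℝ) ≤ X := Nat.floor_le hX0
  have hXN : X / 2 ≤ N := by
    have := Nat.lt_floor_add_one X
    rw [← hN] at this
    linarith
  have hN2 : (2 : ℝ) ≤ N := by exact_mod_cast (show 2 ≤ N by omega)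
  have hlogN : 0 < Real.log N := Real.log_pos (by linarith)
  -- the (NT) inequality at `x = X`, `y = X`
  have hsqrt : X ^ (1 / 2 : ℝ) < X := by
    have := Real.rpow_lt_rpow_of_exponent_lt hX1 (show (1 / 2 : ℝ) < 1 by norm_num)
    rwa [Real.rpow_one] at this
  have hmain := hNT' X X hXc hsqrt le_rfl
  -- identify the left-hand sides
  have hpos : ∀ n ∈ Finset.Ioc N ⌊X + X⌋₊, ∀ i, (1 : ℤ) ≤ (f i).eval (n : ℤ) := by
    intro n hn i
    exact hn₀ n (by have := (Finset.mem_Ioc.mp hn).1; omega) i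
  have hfilter : (Finset.Ioc N ⌊X + X⌋₊).filter (fun n : ℕ => (∏ j, f j).eval (n : ℤ) ≠ 0) = Finset.Ioc N ⌊X + X⌋₊ := by
    refine Finset.filter_true_of_mem fun n hn => ?_
    rw [Polynomial.eval_prod]
    exact Finset.prod_ne_zero_iff.mpr fun i _ => by have := hpos n hn i; omega
  have hLHS : (∑ n ∈ Finset.Ioc ⌊X⌋₊ ⌊2 * X⌋₊, ∏ i, y ^ cardFactors (val f i n / smoothPart P (val f i n))) =
      ∑ n ∈ (Finset.Ioc N ⌊X + X⌋₊).filter (fun n : ℕ => (∏ j, f j).eval (n : ℤ) ≠ 0),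
        (fun m : Fin k → ℕ => ∏ i, y ^ cardFactors (m i / smoothPart P (m i)))
          (fun i => ((f i).eval (n : ℤ)).natAbs) := by
    rw [hfilter, two_mul]
    refine Finset.sum_congr rfl fun n hn => Finset.prod_congr rfl fun i _ => ?_
    rw [val_eq_natAbs (hpos n hn) i]
  -- the sieve product
  have hprod : ∏ p ∈ (Finset.Icc 1 ⌊X⌋₊).filter Nat.Prime, (1 - (polyRootCountMod f p : ℝ) / p) ≤
      M * 2 ^ k / Real.log X ^ k := by
    rw [filter_prime_Icc_eq_primesLE]
    refine (hM N (by omega)).trans ?_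
    have hlog2 : Real.log X / 2 ≤ Real.log N := by
      have h4 : Real.log 4 = 2 * Real.log 2 := by
        rw [show (4 : ℝ) = 2 ^ 2 by norm_num, Real.log_pow]
        norm_num
      have hl2 : Real.log 2 ≤ Real.log X / 2 := by
        have := Real.log_le_log (by norm_num) hX4
        linarith
      calc Real.log X / 2 = Real.log X - Real.log X / 2 := by ring
        _ ≤ Real.log X - Real.log 2 := by linarith
        _ = Real.log (X / 2) := by rw [Real.log_div (by linarith) two_ne_zero]
        _ ≤ Real.log N := Real.log_le_log (by linarith) hXN
    have hpow : (Real.log X / 2) ^ k ≤ Real.log N ^ k := pow_le_pow_left₀ (by positivity) hlog2 k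
    rw [div_le_div_iff₀ (pow_pos hlogN k) (pow_pos hlogX k)]
    calc M * Real.log X ^ k = M * 2 ^ k * (Real.log X / 2) ^ k := by
          rw [div_pow, mul_assoc, mul_div_cancel₀ _ (pow_ne_zero k two_ne_zero)]
      _ ≤ M * 2 ^ k * Real.log N ^ k := mul_le_mul_of_nonneg_left hpow (by positivity)
  -- the harmonic sum
  have hsum : (∑ n ∈ (Fintype.piFinset fun _ : Fin k => Finset.Icc 1 ⌊X⌋₊).filter
        (fun n => ∏ j, n j ≤ ⌊X⌋₊),
      (fun m : Fin k → ℕ => ∏ i, y ^ cardFactors (m i / smoothPart P (m i))) n *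
        ∏ j, ((polyRootCountMod ![f j] (n j) : ℝ) / (n j))) ≤ K' ^ k * (Real.log X ^ y) ^ k := by
    have hterm0 : ∀ n : Fin k → ℕ, 0 ≤ (fun m : Fin k → ℕ => ∏ i, y ^ cardFactors (m i / smoothPart P (m i))) n *
        ∏ j, ((polyRootCountMod ![f j] (n j) : ℝ) / (n j)) := fun n =>
      mul_nonneg (Finset.prod_nonneg fun i _ => pow_nonneg hy0 _)
        (Finset.prod_nonneg fun j _ => div_nonneg (Nat.cast_nonneg _) (Nat.cast_nonneg _))
    calc _ ≤ ∑ n ∈ (Fintype.piFinset fun _ : Fin k => Finset.Icc 1 N),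
          (fun m : Fin k → ℕ => ∏ i, y ^ cardFactors (m i / smoothPart P (m i))) n *
            ∏ j, ((polyRootCountMod ![f j] (n j) : ℝ) / (n j)) :=
          Finset.sum_le_sum_of_subset_of_nonneg (Finset.filter_subset _ _) fun n _ _ => hterm0 n
      _ = ∑ n ∈ (Fintype.piFinset fun _ : Fin k => Finset.Icc 1 N),
          ∏ j, (y ^ cardFactors (n j / smoothPart P (n j)) * ((polyRootCountMod ![f j] (n j) : ℝ) / (n j))) :=
          Finset.sum_congr rfl fun n _ => by
            simp only
            rw [← Finset.prod_mul_distrib]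
      _ = ∏ j : Fin k, ∑ m ∈ Finset.Icc 1 N,
          y ^ cardFactors (m / smoothPart P m) * ((polyRootCountMod ![f j] m : ℝ) / m) :=
          (Finset.prod_univ_sum (fun _ : Fin k => Finset.Icc 1 N)
            (fun j m => y ^ cardFactors (m / smoothPart P m) * ((polyRootCountMod ![f j] m : ℝ) / m))).symm
      _ ≤ ∏ _j : Fin k, K' * Real.log X ^ y := by
          refine Finset.prod_le_prod (fun j _ => Finset.sum_nonneg fun m _ => by positivity) fun j _ => ?_
          calc ∑ m ∈ Finset.Icc 1 N, y ^ cardFactors (m / smoothPart P m) * ((polyRootCountMod ![f j] m : ℝ) / m)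
              ≤ ∑ m ∈ Finset.Icc 1 N, y ^ cardFactors m * (polyRootCountMod ![f j] m : ℝ) / m := by
                refine Finset.sum_le_sum fun m hm => ?_
                have hm0 : m ≠ 0 := by have := (Finset.mem_Icc.mp hm).1; omega
                rw [mul_div_assoc]
                exact mul_le_mul_of_nonneg_right (pow_le_pow_right₀ hy (cardFactors_div_smoothPart_le P hm0))
                  (by positivity)
            _ ≤ K * Real.log N ^ y := hK j N (by omega)
            _ ≤ K' * Real.log N ^ y :=
                mul_le_mul_of_nonneg_right (le_max_left _ _) (Real.rpow_nonneg hlogN.le _)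
            _ ≤ K' * Real.log X ^ y :=
                mul_le_mul_of_nonneg_left (Real.rpow_le_rpow hlogN.le (Real.log_le_log (by linarith) hNX) hy0)
                  (le_max_right _ _)
      _ = K' ^ k * (Real.log X ^ y) ^ k := by
          rw [Finset.prod_const, Finset.card_univ, Fintype.card_fin, mul_pow]
  -- assemble
  have hS0 : 0 ≤ ∑ n ∈ (Fintype.piFinset fun _ : Fin k => Finset.Icc 1 ⌊X⌋₊).filter
        (fun n => ∏ j, n j ≤ ⌊X⌋₊),
      (fun m : Fin k → ℕ => ∏ i, y ^ cardFactors (m i / smoothPart P (m i))) n *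
        ∏ j, ((polyRootCountMod ![f j] (n j) : ℝ) / (n j)) :=
    Finset.sum_nonneg fun n _ => mul_nonneg (Finset.prod_nonneg fun i _ => pow_nonneg hy0 _)
      (Finset.prod_nonneg fun j _ => div_nonneg (Nat.cast_nonneg _) (Nat.cast_nonneg _))
  have hP0 : 0 ≤ ∏ p ∈ (Finset.Icc 1 ⌊X⌋₊).filter Nat.Prime, (1 - (polyRootCountMod f p : ℝ) / p) :=
    Finset.prod_nonneg fun p hp => by
      have hp' := (Finset.mem_filter.mp hp).2
      have hlt := hf.hasNoFixedPrimeDivisor p hp'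
      have hp0 : (0 : ℝ) < p := by exact_mod_cast hp'.pos
      rw [sub_nonneg, div_le_one hp0]
      exact_mod_cast hlt.le
  have hpowlog : (Real.log X ^ y) ^ k / Real.log X ^ k = Real.log X ^ ((k : ℝ) * (y - 1)) := by
    rw [← Real.rpow_mul_natCast hlogX.le, ← Real.rpow_natCast (Real.log X) k, ← Real.rpow_sub hlogX]
    congr 1
    ring
  rw [hLHS]
  calc _ ≤ C * X * (∏ p ∈ (Finset.Icc 1 ⌊X⌋₊).filter Nat.Prime, (1 - (polyRootCountMod f p : ℝ) / p)) *
        ∑ n ∈ (Fintype.piFinset fun _ : Fin k => Finset.Icc 1 ⌊X⌋₊).filter (fun n => ∏ j, n j ≤ ⌊X⌋₊),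
          (fun m : Fin k → ℕ => ∏ i, y ^ cardFactors (m i / smoothPart P (m i))) n *
            ∏ j, ((polyRootCountMod ![f j] (n j) : ℝ) / (n j)) := hmain
    _ ≤ |C| * X * (M * 2 ^ k / Real.log X ^ k) * (K' ^ k * (Real.log X ^ y) ^ k) := by
        have h1 : C * X * (∏ p ∈ (Finset.Icc 1 ⌊X⌋₊).filter Nat.Prime, (1 - (polyRootCountMod f p : ℝ) / p))
            ≤ |C| * X * (M * 2 ^ k / Real.log X ^ k) :=
          calc _ ≤ |C| * X * (∏ p ∈ (Finset.Icc 1 ⌊X⌋₊).filter Nat.Prime, (1 - (polyRootCountMod f p : ℝ) / p)) :=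
                mul_le_mul_of_nonneg_right (mul_le_mul_of_nonneg_right (le_abs_self C) hX0) hP0
            _ ≤ _ := mul_le_mul_of_nonneg_left hprod (by positivity)
        exact mul_le_mul h1 hsum hS0 (by positivity)
    _ = |C| * (M * 2 ^ k) * K' ^ k * (X * ((Real.log X ^ y) ^ k / Real.log X ^ k)) := by
        field_simp
    _ = |C| * (M * 2 ^ k) * K' ^ k * (X * Real.log X ^ ((k : ℝ) * (y - 1))) := by rw [hpowlog]

end

end Summit.Parity.BatemanHorn.Cruxes.LSDRealSegment.ProductAnatomySubcritical
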